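import Summits.CriticalPhenomena.CardyFormulaZ2.Theorems.CardyUniqueLimitCardyRigidityPercDrivingTailOfLimitG2
import Summits.CriticalPhenomena.CardyFormulaZ2.Theorems.CardyComplexConeParafermionToSLESixFamiliesPercKSBoxFaceReduction
import HarnessLib

/-!
# Stub A2 from box tightness and Condition G2 in `ℍ` for the FACE-DOMAIN system
(line `crossing-martingale`, crux `CardyRigidity`, stub A2 `stub_percDrivingTail`)

Crux `Summit.CriticalPhenomena.CardyFormulaZ2.Theses.CardyUniqueLimit.CardyRigidity`
(stmt-CriticalPhenomena-0746), line `crossing_martingale`.  Stub A2 `stub_percDrivingTail`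
(`∀ D E, ZdDiscretisationFamily D E → Driver.PercDrivingTail D E`) quantifies over ALL systems of
approximating Dobrushin domains with chordal maps through which the interfaces are box-tight;
the percolation estimates (Russo–Seymour–Welsh, domain Markov property) live on the CANONICAL
system — the oriented polygonal face domains `orientedFaceDomain hΛ (hadm k)` of the data, in
whose closure the interface runs (`BondInterfaceFaceDomain.lean`), with chordal maps from the
kernel theorem (`PercKSBoxFaceReduction.lean`), the system of STUB A1 `PercFaceBoxTight`.
This file closes that gap:

* `Driver.PercFaceHalfPlaneG2` (definition) — Condition G2 in `ℍ` for the bond-`ℤ²` interfaces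
  read through ANY chordal maps `φ_k` of the oriented face domains with (U1), (U2): ONE ratio
  `C > 1` such that for every capacity horizon `u > 0` and bound `Z`, for all large `k`, a
  measurable choice of classes of the capacity-`u` truncations of the pulled-back interfaces
  `Loewner.trace (drivingFunction φ_k ·)` has a law satisfying the boundary-annulus crossing
  bound (inner radius `2√u`, centres `|z₀| ≤ Z`) — exactly the instances used by
  Kemppainen–Smirnov's Prop. 3.7, for the canonical system (the binder structure of
  `PercFaceBoxTight`, whose conclusion — box tightness — is a hypothesis here);
* `Driver.limitTail_of_face` — `PercFaceBoxTight → PercFaceHalfPlaneG2 →` the limit tail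
  hypothesis of `Driver.percDrivingTail_of_limitTail`: uniform sub-exponential tails of
  `sup_{[0,t]} |drivingFunction φ|` under EVERY subsequential limit law of the interfaces
  (realise the limit along positive admissible meshes, `Driver.exists_seq_admissible_of_isSubseqLimitLaw_bond`;
  build the face-domain system with (U1), (U2), `b_k → b` as in `percKSBoxData_of_face`;
  discrete tails with EXPLICIT constants from `KSBridge.measure_exists_le_abs_driving_le_of_rectangleExit`
  and `Driver.ae_exists_pair_of_boxTight`; pass to the limit by the portmanteau theorem for the
  open set `{m < sup_{[0,t]} |w|}`, `Process.measure_lt_comp_le_of_tendstoInDistribution`, after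
  `ae_isLoewnerDescribable_and_tendstoInDistribution_drivingPath_varying`);
* `Driver.percDrivingTail_of_face`, `tail_percDrivingTail_of_face` (registered shape) —
  `PercFaceBoxTight → PercFaceHalfPlaneG2 → ∀ D E, ZdDiscretisationFamily D E → PercDrivingTail D E`:
  STUB A2 from STUB A1 and Condition G2 in `ℍ` for the canonical system.

References: A. Kemppainen, S. Smirnov, Ann. Probab. 45 (2017), §2.1.3, §2.2, §3.3
Prop. 3.7–3.8, Thm. 1.5 (v); CDHKS, C. R. Math. 352 (2014), §2–3.
-/

noncomputable section

open MeasureTheory Filter Set Topology Metric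
open scoped NNReal ENNReal BoundedContinuousFunction
open UpperHalfPlane (upperHalfPlaneSet)
open Literature.Probability Literature.Probability.RandomPlanarGeometry
  Literature.Probability.LatticeModels Literature.Probability.Percolation
open scoped Literature.Probability.RandomPlanarGeometry.PathBorel
open Summit.CriticalPhenomena.CardyFormulaZ2.Cruxes.ParafermionToSLESixFamilies.CaratheodoryNetSlitUniformity
  (PercFaceBoxTight)
open Summit.CriticalPhenomena.CardyFormulaZ2.Cruxes.ParafermionToSLESixFamilies.FaceKernel
  (percFaceKernel)

namespace Summit.CriticalPhenomena.CardyFormulaZ2.Cruxes.CardyRigidity.CrossingMartingale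
-- buildfix lane 2026-08-20: namespace-local alias(es) so that short names made ambiguous by the
-- 2026-08-15 Literature migration (old home vs re-exported new home, both in the import cone) resolve,
-- as in the accepted build, to the OLD home `Literature.Probability.Percolation`. No declaration text changes.
export Literature.Probability.Percolation (bondInterfaceIn bondInterfaceIn_apply)

namespace Driver

/-- **Condition G2 in `ℍ` for the bond-`ℤ²` interfaces in the oriented face domains.**  There
is ONE ratio `C > 1` such that for every Dobrushin domain `(D; a, b)`, discretisation family
`Λ`, chordal `φ`, positive admissible meshes `δ_k → 0` and every system of chordal maps `φ_k` of
the oriented face domains of the data whose boundary extensions converge to that of `φ` ((U1),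
(U2)) and through which the interfaces are box-tight (the conclusion of `PercFaceBoxTight`, so
that at each scale the interface is a.s. `⟦Φ_k ∘ γ̂_k⟧` for a Loewner pair from `0`): for every
capacity horizon `u > 0` and bound `Z`, for all large `k`, some measurable
choice `crv ω` of curve classes with a.s. `(crv ω).source = 0`,
`(crv ω).range = γ̂_k(ω)([0, u])`, `γ̂_k(ω) = Loewner.trace (drivingFunction φ_k
(bondInterfaceIn D (Λ δ_k) ω))`, has a law under which, for every nonempty closed `F`, real
centre `|z₀| ≤ Z` and measurable set `S` of pasts avoiding `B(z₀, 2C√u)`,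
`P_{1/2}(stopAt F ∈ S ∧ startFrom F crosses A(z₀, 2√u, 2C√u)) ≤ ½ P_{1/2}(stopAt F ∈ S)` —
Kemppainen–Smirnov's Condition G2 (§2.1.3) for the exploration of critical bond percolation
(Russo–Seymour–Welsh and the domain Markov property, KS §4.2) transported to `ℍ` (§2.2), in
the instances used by Prop. 3.7 (Kemppainen–Smirnov 2017, Ann. Probab. 45, §2.1.3, §2.2,
Prop. 3.7; a sub-goal PREDICATE of the crux, deliberately not a cited Literature fact). -/
def PercFaceHalfPlaneG2 : Prop :=
  ∃ C : ℝ, 1 < C ∧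
  ∀ (D : DobrushinDomain) (Λ : ℝ → DiscreteDobrushin) (hΛ : ZdDiscretisationFamily D Λ)
    (φ : ConformalEquiv upperHalfPlaneSet D.carrier), D.IsChordalUniformizing φ →
    ∀ (δs : ℕ → ℝ), (∀ k, 0 < δs k) → Tendsto δs atTop (𝓝 0) →
    ∀ (hadm : ∀ k, (Λ (δs k)).IsZdAdmissible)
      (φs : ∀ k, ConformalEquiv upperHalfPlaneSet (orientedFaceDomain hΛ (hadm k)).carrier),
      (∀ k, (orientedFaceDomain hΛ (hadm k)).IsChordalUniformizing (φs k)) →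
      (∀ R : ℝ, TendstoUniformlyOn (fun k ↦ (φs k).boundaryExtension) φ.boundaryExtension
        atTop ({z : ℂ | 0 ≤ z.im} ∩ closedBall 0 R)) →
      (∀ ε : ℝ, 0 < ε → ∃ r : ℝ, ∀ᶠ k in atTop, ∀ z : ℂ, z ∈ {z : ℂ | 0 ≤ z.im} → r ≤ ‖z‖ →
        dist ((φs k).boundaryExtension z) ((orientedFaceDomain hΛ (hadm k)).pt 1) ≤ ε) →
      (∀ ε : ℝ≥0∞, 0 < ε → ∃ (δγ δW : ℕ → ℝ) (T : ℕ → ℝ≥0), (∀ j, 0 < δγ j) ∧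
        (∀ j, 0 < δW j) ∧
        ∀ k, bondPercolation (zdGraph 2) half ((bondInterfaceIn D (Λ (δs k))) ⁻¹'
          ((fun p ↦ compactifiedClass (φs k).boundaryExtension
              ((orientedFaceDomain hΛ (hadm k)).pt 1) p.1) ''
            {p : C(ℝ≥0, ℂ) × C(ℝ≥0, ℝ) | p ∈ generatedPairs ∧
              p.1 ∈ Process.modulusSet ({0} : Set ℂ) δγ ∧
              p.2 ∈ Process.modulusSet ({0} : Set ℝ) δW ∧
              ∀ (j : ℕ) (t : ℝ≥0), T j ≤ t → (j : ℝ) ≤ ‖p.1 t‖})ᶜ) ≤ ε) →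
      ∀ u : ℝ≥0, 0 < u → ∀ Z : ℝ, ∀ᶠ k in atTop,
        ∃ crv : BondConfig (Site 2) → CurveClass ℂ,
          AEMeasurable crv (bondPercolation (zdGraph 2) half) ∧
          (∀ᵐ ω ∂bondPercolation (zdGraph 2) half, (crv ω).source = 0 ∧
            (crv ω).range = (Loewner.trace
              (drivingFunction (φs k) (bondInterfaceIn D (Λ (δs k)) ω))) '' Icc 0 u) ∧
          ∀ F : Set ℂ, IsClosed F → F.Nonempty → ∀ z₀ : ℝ, |z₀| ≤ Z →
            ∀ S : Set (CurveClass ℂ), MeasurableSet S →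
            S ⊆ {p | Disjoint p.range (ball ((z₀ : ℝ) : ℂ) (C * (2 * Real.sqrt u)))} →
            (bondPercolation (zdGraph 2) half).map crv (CurveClass.stopAt F ⁻¹' S ∩
                {c | c.startFrom F ∈ CurveClass.crossingIn ((z₀ : ℝ) : ℂ) (2 * Real.sqrt u)
                  (C * (2 * Real.sqrt u)) univ}) ≤
              2⁻¹ * (bondPercolation (zdGraph 2) half).map crv (CurveClass.stopAt F ⁻¹' S)

/-- **Uniform sub-exponential tails of the driving function under every subsequential limit,
from box tightness and Condition G2 in `ℍ` for the face-domain system** (Kemppainen–Smirnov's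
Thm. 1.5 (v) for the bond-`ℤ²` interfaces, modulo its two lattice inputs): for every `t` there
are `K`, `r > 0` with `μ{∃ s ≤ t, n ≤ |drivingFunction φ c s|} ≤ K e^{-r n}` for every
subsequential limit law `μ` of the interfaces of `(D, Λ)` and all `n` — the hypothesis `hT` of
`percDrivingTail_of_limitTail`.  Constants: `K = 4 e^{2c} e^{r}`, `r = c/(581 √(t+1))`,
`c = log 2/(2C)`. [cite: KemppainenSmirnov2017, Thm. 1.5 (v), Prop. 3.7 and Prop. 3.8] -/
theorem limitTail_of_face (hBT : PercFaceBoxTight) (hG2 : PercFaceHalfPlaneG2)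
    {D : DobrushinDomain} {Λ : ℝ → DiscreteDobrushin} (hΛ : ZdDiscretisationFamily D Λ)
    {φ : ConformalEquiv upperHalfPlaneSet D.carrier} (hφ : D.IsChordalUniformizing φ)
    (t : ℝ≥0) :
    ∃ (K r : ℝ), 0 < r ∧ ∀ μ : Measure (CurveClass ℂ), IsProbabilityMeasure μ →
      IsSubseqLimitLaw (fun δ ↦ bondInterfaceIn D (Λ δ)) (fun _ ↦ bondPercolation (zdGraph 2) half) μ →
      (∀ᵐ c ∂μ, IsLoewnerDescribable φ c) → (∀ᵐ c ∂μ, c.source = D.pt 0) →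
      ∀ n : ℕ, μ {c | ∃ s, s ≤ t ∧ (n : ℝ) ≤ |drivingFunction φ c s|} ≤
        ENNReal.ofReal (K * Real.exp (-r * n)) := by
  obtain ⟨C, hC, hG2'⟩ := hG2
  set Pc : Measure (BondConfig (Site 2)) := bondPercolation (zdGraph 2) half with hPc
  haveI hPcI : IsProbabilityMeasure Pc := by rw [hPc]; infer_instance
  set u : ℝ≥0 := t + 1 with hudef
  have hu : 0 < u := by positivity
  set c : ℝ := Real.log 2 / (2 * C) with hcdef
  have hC0 : 0 < C := zero_lt_one.trans hC
  have hc : 0 < c := by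
    have := Real.log_pos one_lt_two
    positivity
  set r : ℝ := c / (581 * Real.sqrt u) with hrdef
  have hr : 0 < r := by positivity
  refine ⟨4 * Real.exp (2 * c) * Real.exp r, r, hr, fun μ hμ hsub _ _ n ↦ ?_⟩
  haveI := hμ
  -- realise the limit along positive admissible meshes
  obtain ⟨-, δs, hpos, hlim, hadm, hconv⟩ := exists_seq_admissible_of_isSubseqLimitLaw_bond hΛ hsub
  -- the face-domain system with chordal maps for the given `φ` (as in `percKSBoxData_of_face`)
  set Ds : ℕ → DobrushinDomain := fun k ↦ orientedFaceDomain hΛ (hadm k) with hDs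
  obtain ⟨hK1, hlc⟩ := percFaceKernel D Λ hΛ δs hpos hlim hadm
  obtain ⟨R, hR, hB⟩ := exists_forall_orientedFaceDomain_subset_ball hΛ
  have hB' : ∃ R > 0, ∀ᶠ k in atTop, (Ds k).carrier ⊆ ball 0 R :=
    ⟨R, hR, Eventually.of_forall fun k ↦ hB (hadm k)⟩
  have hK2 : ∀ w ∉ D.carrier, ∀ r : ℝ, 0 < r → ∀ᶠ k in atTop, ¬ ball w r ⊆ (Ds k).carrier :=
    fun w hw r hr ↦ Eventually.of_forall fun k ↦ not_ball_subset_orientedFaceDomain hΛ (hadm k) hw hr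
  obtain ⟨ha, hb⟩ := tendsto_pt_orientedFaceDomain hΛ hpos hlim hadm
  obtain ⟨φs, hφs, -, hU1, hU2⟩ :=
    MarkedDomain.exists_uniformizers_of_kernel_of_isChordalUniformizing (Ds := Ds) hB' hK1 hK2 hlc
      ha hb φ hφ
  -- the two lattice inputs on this system
  have hbox := hBT D Λ hΛ φ hφ δs hpos hlim hadm φs hφs hU1 hU2
  have hGk := hG2' D Λ hΛ φ hφ δs hpos hlim hadm φs hφs hU1 hU2 hbox
  -- the interface laws, weak convergence, box tightness in law form
  set Y : ∀ k : ℕ, BondConfig (Site 2) → CurveClass ℂ := fun k ↦ bondInterfaceIn D (Λ (δs k))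
    with hYdef
  have hYm : ∀ k, AEMeasurable (Y k) Pc := fun k ↦ (measurable_bondInterfaceIn D _).aemeasurable
  set μs : ℕ → Measure (CurveClass ℂ) := fun k ↦ Pc.map (Y k) with hμsdef
  haveI hμsP : ∀ k, IsProbabilityMeasure (μs k) := fun k ↦
    Measure.isProbabilityMeasure_map (hYm k)
  have hlim' : ∀ f : CurveClass ℂ →ᵇ ℝ,
      Tendsto (fun k ↦ ∫ c', f c' ∂μs k) atTop (𝓝 (∫ c', f c' ∂μ)) := by
    intro f
    have hint : ∀ k, ∫ c', f c' ∂μs k = ∫ ω, f (Y k ω) ∂Pc := fun k ↦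
      integral_map (hYm k) f.continuous.aestronglyMeasurable
    simp_rw [hint]
    exact hconv f
  have hbox' : ∀ ε : ℝ≥0∞, 0 < ε → ∃ (δγ δW : ℕ → ℝ) (T : ℕ → ℝ≥0), (∀ j, 0 < δγ j) ∧
      (∀ j, 0 < δW j) ∧
      ∀ k, μs k ((fun p ↦ compactifiedClass (φs k).boundaryExtension ((Ds k).pt 1) p.1) ''
        {p : C(ℝ≥0, ℂ) × C(ℝ≥0, ℝ) | p ∈ generatedPairs ∧
          p.1 ∈ Process.modulusSet ({0} : Set ℂ) δγ ∧ p.2 ∈ Process.modulusSet ({0} : Set ℝ) δW ∧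
          ∀ (i : ℕ) (t : ℝ≥0), T i ≤ t → (i : ℝ) ≤ ‖p.1 t‖})ᶜ ≤ ε := by
    intro ε hε
    obtain ⟨δγ, δW, T, hδγ, hδW, hall⟩ := hbox ε hε
    refine ⟨δγ, δW, T, hδγ, hδW, fun k ↦ ?_⟩
    set 𝒦 : Set (C(ℝ≥0, ℂ) × C(ℝ≥0, ℝ)) := {p | p ∈ generatedPairs ∧
      p.1 ∈ Process.modulusSet ({0} : Set ℂ) δγ ∧ p.2 ∈ Process.modulusSet ({0} : Set ℝ) δW ∧
      ∀ (i : ℕ) (t : ℝ≥0), T i ≤ t → (i : ℝ) ≤ ‖p.1 t‖} with h𝒦def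
    have h𝒦 : IsCompact 𝒦 := isCompact_pairBox hδγ hδW T
    have htrans : ∀ r : ℝ, ∃ T' : ℝ≥0, ∀ p ∈ 𝒦, ∀ t, T' ≤ t → r ≤ ‖p.1 t‖ := fun r ↦
      ⟨T ⌈r⌉₊, fun p hp t ht ↦ (Nat.le_ceil r).trans (hp.2.2.2 _ t ht)⟩
    have hclosed : IsClosed ((fun p ↦ compactifiedClass (φs k).boundaryExtension
        ((Ds k).pt 1) p.1) '' 𝒦) :=
      (isClosed_image_and_continuousOn_drivingPath (hφs k) h𝒦 (fun p hp ↦ hp.1) htrans).2.2.1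
    change (Pc.map (Y k)) _ ≤ ε
    rw [Measure.map_apply_of_aemeasurable (hYm k) hclosed.measurableSet.compl]
    exact hall k
  -- Kemppainen–Smirnov's deterministic half: driving convergence towards `drivingFunction φ`
  obtain ⟨-, hTD⟩ :=
    ae_isLoewnerDescribable_and_tendstoInDistribution_drivingPath_varying hφ hφs hU1 hU2 hb
      hlim' hbox'
  have hTD' := tendstoInDistribution_comp_of_map_eq (P := fun _ ↦ Pc) hTD Y hYm fun k ↦ rfl
  -- discrete tails with explicit constants at every level `m`, eventually in `k`
  have hdisc : ∀ m : ℕ, ∀ᶠ k in atTop, Pc {ω | ∃ s ≤ u, (m : ℝ) ≤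
      |drivingFunction (φs k) (Y k ω) s|} ≤
      ENNReal.ofReal (4 * Real.exp (2 * c) * Real.exp (-(c / 581 * m / Real.sqrt u))) := by
    intro m
    filter_upwards [hGk u hu ((m : ℝ) / 581)] with k hk
    obtain ⟨crv, hcrv, hrep, hGcrv⟩ := hk
    have hpair : ∀ᵐ ω ∂Pc, Loewner.IsGeneratedByCurve (drivingFunction (φs k) (Y k ω))
        (Loewner.trace (drivingFunction (φs k) (Y k ω))) ∧
        Continuous (drivingFunction (φs k) (Y k ω)) ∧ drivingFunction (φs k) (Y k ω) 0 = 0 := by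
      filter_upwards [ae_exists_pair_of_boxTight Pc (hφs k) (Y k)
        (fun ε hε ↦ (hbox ε hε).imp fun δγ ⟨δW, T, hδγ, hδW, hall⟩ ↦ ⟨δW, T, hδγ, hδW, hall k⟩)]
        with ω hω
      obtain ⟨p, hp, -, hp2, -, hWp⟩ := hω
      have hW : drivingFunction (φs k) (Y k ω) = p.2 := hWp
      have hgen : Loewner.IsGeneratedByCurve (drivingFunction (φs k) (Y k ω)) p.1 := by
        rw [hW]; exact hp
      have hγ : Loewner.trace (drivingFunction (φs k) (Y k ω)) = p.1 :=
        Loewner.IsGeneratedByCurve.trace_eq_holds (by rw [hW]; exact p.2.continuous) hgen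
      refine ⟨by rw [hγ]; exact hgen, by rw [hW]; exact p.2.continuous, by rw [hW]; exact hp2⟩
    have h := KSBridge.measure_exists_le_abs_driving_le_of_rectangleExit Pc hpair hu hC crv hcrv
      hrep m hGcrv
    rwa [← hcdef] at h
  -- pass to the limit: portmanteau for the open set `{m < sup_{[0,t]} |w|}`
  haveI := isCompact_iff_compactSpace.1 (isCompact_Icc (a := (0 : ℝ≥0)) (b := t))
  set g : C(ℝ≥0, ℝ) → ℝ := fun w ↦ ‖w.restrict (Icc (0 : ℝ≥0) t)‖ with hgdef
  have hg : Continuous g := Process.continuous_norm_restrict_Icc t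
  have hlimit : ∀ m : ℕ, μ {c' | (m : ℝ) < g (⟨drivingFunction φ c', continuous_drivingFunction φ c'⟩ :
      C(ℝ≥0, ℝ))} ≤
      ENNReal.ofReal (4 * Real.exp (2 * c) * Real.exp (-(c / 581 * m / Real.sqrt u))) := by
    intro m
    refine Process.measure_lt_comp_le_of_tendstoInDistribution hTD' hg m ?_
    filter_upwards [hdisc m] with k hk
    refine le_trans (measure_mono fun ω hω ↦ ?_) hk
    obtain ⟨s, hs, hlt⟩ := (Process.lt_norm_restrict_Icc_iff
      (⟨fun v ↦ drivingFunction (φs k) (Y k ω) v, continuous_drivingFunction (φs k) (Y k ω)⟩ :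
        C(ℝ≥0, ℝ)) (Nat.cast_nonneg m)).1 hω
    exact ⟨s, hs.trans (by rw [hudef]; exact le_self_add), hlt.le⟩
  -- level `n`: `{∃ s ≤ t, n ≤ |W s|} ⊆ {n - 1 < sup_{[0,t]} |W|}` for `n ≥ 1`; trivial for `n = 0`
  rcases Nat.eq_zero_or_pos n with rfl | hn
  · calc μ {c' | ∃ s, s ≤ t ∧ ((0 : ℕ) : ℝ) ≤ |drivingFunction φ c' s|} ≤ μ univ :=
          measure_mono (subset_univ _)
      _ = 1 := measure_univ
      _ ≤ _ := by
          rw [← ENNReal.ofReal_one]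
          refine ENNReal.ofReal_le_ofReal ?_
          rw [Nat.cast_zero, mul_zero, Real.exp_zero, mul_one]
          have h1 : (1 : ℝ) ≤ Real.exp (2 * c) := Real.one_le_exp (by positivity)
          have h2 : (1 : ℝ) ≤ Real.exp r := Real.one_le_exp hr.le
          have h3 : (1 : ℝ) * 1 ≤ Real.exp (2 * c) * Real.exp r :=
            mul_le_mul h1 h2 zero_le_one (zero_le_one.trans h1)
          have h4 : 4 * Real.exp (2 * c) * Real.exp r = 4 * (Real.exp (2 * c) * Real.exp r) := by
            ring
          rw [h4]
          linarith
  · obtain ⟨m, rfl⟩ := Nat.exists_eq_succ_of_ne_zero hn.ne'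
    calc μ {c' | ∃ s, s ≤ t ∧ ((m + 1 : ℕ) : ℝ) ≤ |drivingFunction φ c' s|}
        ≤ μ {c' | (m : ℝ) < g (⟨drivingFunction φ c', continuous_drivingFunction φ c'⟩ :
            C(ℝ≥0, ℝ))} := by
          refine measure_mono fun c' hc' ↦ ?_
          obtain ⟨s, hs, hle⟩ := hc'
          refine (Process.lt_norm_restrict_Icc_iff _ (Nat.cast_nonneg m)).2 ⟨s, hs, ?_⟩
          have : (m : ℝ) < ((m + 1 : ℕ) : ℝ) := by push_cast; linarith
          exact this.trans_le hle
      _ ≤ ENNReal.ofReal (4 * Real.exp (2 * c) * Real.exp (-(c / 581 * m / Real.sqrt u))) :=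
          hlimit m
      _ = ENNReal.ofReal (4 * Real.exp (2 * c) * Real.exp r * Real.exp (-r * ((m + 1 : ℕ) : ℝ))) := by
          congr 1
          rw [mul_assoc (4 * Real.exp (2 * c)), ← Real.exp_add]
          congr 2
          rw [hrdef]
          push_cast
          ring

/-- **STUB A2 from STUB A1 and Condition G2 in `ℍ` for the face-domain system.**  Box tightness
of the interfaces in the oriented face domains (`PercFaceBoxTight`) and Condition G2 in `ℍ` for
that system (`PercFaceHalfPlaneG2`) give `Driver.PercDrivingTail D E` for every discretisation
family — for ALL approximating systems of its hypotheses (`limitTail_of_face` and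
`percDrivingTail_of_limitTail`). [cite: KemppainenSmirnov2017, Thm. 1.5 (v) and Prop. 3.8] -/
theorem percDrivingTail_of_face (hBT : PercFaceBoxTight) (hG2 : PercFaceHalfPlaneG2)
    (D : DobrushinDomain) (E : ℝ → DiscreteDobrushin) (hE : ZdDiscretisationFamily D E) :
    PercDrivingTail D E := by
  intro _ hφ _ hδpos hδ0 _ _ _ hφs hU1 hU2 hb hbox t
  exact percDrivingTail_of_limitTail hE hφ hδpos hδ0 hφs hU1 hU2 hb hbox
    (fun t' ↦ limitTail_of_face hBT hG2 hE hφ t') t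

end Driver

/-- **Registered-shape form** (glue sub-goal `tail_percDrivingTail_of_face` of
stmt-CriticalPhenomena-0746): STUB A1 (`PercFaceBoxTight`) and Condition G2 in `ℍ` for the
face-domain system (`Driver.PercFaceHalfPlaneG2`) imply STUB A2
`∀ D E, ZdDiscretisationFamily D E → Driver.PercDrivingTail D E`.
[cite: KemppainenSmirnov2017, Thm. 1.5 (v) and Prop. 3.8] -/
theorem tail_percDrivingTail_of_face : PercFaceBoxTight → Driver.PercFaceHalfPlaneG2 → ∀ (D : DobrushinDomain) (E : ℝ → DiscreteDobrushin), ZdDiscretisationFamily D E → Driver.PercDrivingTail D E :=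
  fun hBT hG2 D E hE ↦ Driver.percDrivingTail_of_face hBT hG2 D E hE

end Summit.CriticalPhenomena.CardyFormulaZ2.Cruxes.CardyRigidity.CrossingMartingale

end
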